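import Summits.ValiantsHypothesis.ValiantsHypothesis.Theorems.BarrierLeverPartitionMinorsChowSizeFive
import Literature.Barriers.ValiantsHypothesis.BDGIL24AffineInputsVP

/-!
# Route BarrierLever — items `ChowHitsPartitionMinors` (stmt-ValiantsHypothesis-20172) and
# `PartitionMinorsHitByVP` (stmt-ValiantsHypothesis-19717): their SIZE-`≤ 5` slices, unconditionally

Helper file (`--supports stmt-ValiantsHypothesis-19717`; cell valiant-natproofs, rung V4, 𝒟-side of
door (c); seat val-np-p4 gen 12).  Closes NO item; imports `…ChowSizeFive` (`chowHits_of_size_le_five`: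
every injective layout pair of size `r ≤ 5` is hit by a product of `h + h` affine forms, at every
height `h`) and the route-independent Literature module
`Literature.Barriers.ValiantsHypothesis.BDGIL24AffineInputsVP` (`SmallCircuits`,
`BergEtAl2024.complexity_le_of_totalDegree_le_one`, `complexity_finset_prod_le`); no definitions, no
route file in the import cone.

* `chowHitsPartitionMinors_of_size_le_five` — item 20172's statement VERBATIM with the extra
  hypothesis `r ≤ 5` (threshold `h₀ = 0`): for every height, every partition minor of size at most `5`
  of some product of `h + h` affine forms is nonzero.
* `prod_affine_mem_smallCircuits_three` — a product of `h + h ≥ 3` affine forms is a small circuit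
  with size exponent `3` (degree `≤ h + h`, size `≤ (h+h)(2(h+h)+1) + (h+h) ≤ (h+h)³`; the bookkeeping
  of `…ChowThinRowsFirstOrderSlice` / `ChowLadder.prod_affine_mem_smallCircuits`, restated here to
  keep the route file out of the imports).
* `partitionMinorsHitByVP_of_size_le_five` — item 19717's statement VERBATIM with the extra hypothesis
  `r ≤ 5` (size exponent `b = 3`, threshold `h₀ = 2`): **for all `h ≥ 2`, every partition minor of
  size at most `5` (rows and columns indexed by arbitrary distinct subsets of `Fin h`) is hit by a
  circuit of degree `≤ h + h` and size `≤ (h + h)³`** — the 𝒟-side door (c) on all layouts of size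
  `≤ 5`, with NO hypothesis.

WHAT THIS IS NOT: bounded-size slices; items 20172 / 19717 ask for minors of every size `r ≤ 2^h` and
are NOT proved; nothing on item 20195, on crux stmt-ValiantsHypothesis-14610, or on `VP` versus `VNP`.
-/

set_option linter.dupNamespace false

namespace Summit.ValiantsHypothesis.ValiantsHypothesis.Theorems.BarrierLever.ChowFactor

open MvPolynomial Literature.Barriers.ValiantsHypothesis Literature.Computability.AlgebraicComplexity

/-- **Size-`≤ 5` slice of item 20172, every height**: item `ChowHitsPartitionMinors` verbatim with
the extra hypothesis `r ≤ 5` — for every `h` (threshold `h₀ = 0`) and every injective layout pair of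
size `r ≤ 5`, some product of `h + h` affine forms has nonsingular partition minor. -/
theorem chowHitsPartitionMinors_of_size_le_five :
    ∃ h₀ : ℕ, ∀ h : ℕ, h₀ ≤ h → ∀ (r : ℕ) (u w : Fin r → Finset (Fin h)), r ≤ 5 →
      Function.Injective u → Function.Injective w →
        ∃ ℓ : Fin (h + h) → MvPolynomial (Fin (h + h)) ℂ, (∀ k, (ℓ k).totalDegree ≤ 1) ∧
          (Matrix.of fun i j : Fin r => MvPolynomial.coeff
            (∑ a ∈ u i, Finsupp.single (Fin.castAdd h a) 1 +
              ∑ c ∈ w j, Finsupp.single (Fin.natAdd h c) 1) (∏ k, ℓ k)).det ≠ 0 :=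
  ⟨0, fun h _ r u w hr hu hw => chowHits_of_size_le_five h r hr u w hu hw⟩

/-- **A product of `h + h` affine forms in `h + h ≥ 3` variables is a small circuit** with size
exponent `3`: degree `≤ h + h`, size `≤ (h+h)(2(h+h)+1) + (h+h) ≤ (h+h)³`. [cite: Burgisser2000, Rem. 2.7] -/
theorem prod_affine_mem_smallCircuits_three {h : ℕ} (h3 : 3 ≤ h + h)
    (ℓ : Fin (h + h) → MvPolynomial (Fin (h + h)) ℂ) (hℓ : ∀ k, (ℓ k).totalDegree ≤ 1) :
    (∏ k, ℓ k) ∈ SmallCircuits ℂ (h + h) 3 := by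
  refine ⟨?_, ?_⟩
  · calc (∏ k, ℓ k).totalDegree ≤ ∑ k, (ℓ k).totalDegree := totalDegree_finsetProd _ _
      _ ≤ ∑ _k : Fin (h + h), 1 := Finset.sum_le_sum fun k _ => hℓ k
      _ = h + h := by simp
  · have hterm : ∀ k, complexity (ℓ k) ≤ 2 * (h + h) + 1 := fun k => by
      simpa [Fintype.card_fin] using BergEtAl2024.complexity_le_of_totalDegree_le_one (hℓ k)
    calc complexity (∏ k, ℓ k)
        ≤ ∑ k, complexity (ℓ k) + (Finset.univ : Finset (Fin (h + h))).card :=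
          complexity_finset_prod_le _ _
      _ ≤ ∑ _k : Fin (h + h), (2 * (h + h) + 1) + (h + h) := by
          rw [Finset.card_univ, Fintype.card_fin]
          exact Nat.add_le_add_right (Finset.sum_le_sum fun k _ => hterm k) _
      _ = (h + h) * (2 * (h + h) + 1) + (h + h) := by simp
      _ ≤ (h + h) ^ 3 := by
          have h2 : 3 * ((h + h) * (h + h)) ≤ (h + h) * ((h + h) * (h + h)) :=
            Nat.mul_le_mul_right ((h + h) * (h + h)) h3
          calc (h + h) * (2 * (h + h) + 1) + (h + h) = 2 * ((h + h) * (h + h)) + 2 * (h + h) := by ring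
            _ ≤ 3 * ((h + h) * (h + h)) := by nlinarith
            _ ≤ (h + h) * ((h + h) * (h + h)) := h2
            _ = (h + h) ^ 3 := by ring

/-- **Size-`≤ 5` slice of item 19717, unconditionally**: item `PartitionMinorsHitByVP` verbatim with
the extra hypothesis `r ≤ 5` — with size exponent `b = 3` and threshold `h₀ = 2`, for every `h ≥ 2`
every partition minor of size `r ≤ 5` on distinct row sets `u i` and distinct column sets `w j` is hit
by some `f ∈ SmallCircuits ℂ (h + h) 3` (the product of affine forms of `chowHits_of_size_le_five`).
[cite: ForbesShpilkaVolk2018, §8] -/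
theorem partitionMinorsHitByVP_of_size_le_five :
    ∃ b h₀ : ℕ, ∀ h : ℕ, h₀ ≤ h → ∀ (r : ℕ) (u w : Fin r → Finset (Fin h)), r ≤ 5 →
      Function.Injective u → Function.Injective w →
        ∃ f ∈ SmallCircuits ℂ (h + h) b,
          (Matrix.of fun i j : Fin r => MvPolynomial.coeff
            (∑ a ∈ u i, Finsupp.single (Fin.castAdd h a) 1 +
              ∑ c ∈ w j, Finsupp.single (Fin.natAdd h c) 1) f).det ≠ 0 := by
  refine ⟨3, 2, fun h hh r u w hr hu hw => ?_⟩
  obtain ⟨ℓ, hℓ, hdet⟩ := chowHits_of_size_le_five h r hr u w hu hw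
  exact ⟨∏ k, ℓ k, prod_affine_mem_smallCircuits_three (by omega) ℓ hℓ, hdet⟩

end Summit.ValiantsHypothesis.ValiantsHypothesis.Theorems.BarrierLever.ChowFactor
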